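import Literature.NumberTheory.EllipticCurves.Kato2004.IwasawaH1ReductionRoots
import HarnessLib

/-!
# Kato 2004 (Astérisque 295) Lemma 8.5 (2): norm-compatible families of classes of `T_pW` along the
# cyclotomic `ℤ_p`-tower are integral — the named fact, and `ker red = p·𝐇¹` on the pin as its corollary

Topic `NumberTheory/EllipticCurves`, sub-directory `Kato2004` (namespace = path).  Cell `bsd-smallim`
(rung K6 of `BirchSwinnertonDyer`, class X9, crux `MuTransferX9` = item 19276), seat `bsd-smallim-k6-g4`
(gen 2).  ONE named fact (`def … : Prop`, D-0014; nothing asserted, no `_holds` here) and one theorem.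

After `IwasawaH1ReductionKernel.lean` (levelwise: `ker (red : H¹(U, T_pW) → H¹(U, W[p])) = p·H¹(U, T_pW)`)
and `IwasawaH1ReductionRoots.lean` (norm-compatible `p`-th roots on the pin by König's lemma, and
`mem_pSmul_of_red_eq_zero_of_integral`), the named fact `Kato2004.mem_pSmul_of_red_eq_zero`
(`IwasawaH1Reduction.lean` §4: Kato §13.8 "`𝐇¹(T)/p𝐇¹(T) ⊂ 𝐇¹(T/p)`" on the pin `IwasawaH1Data`; the
first conjunct of the cite-only stub `stub_factsX9` of crux 19276) is EQUIVALENT over the tree to one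
standard input of Kato's §8: the integrality of universal norms, Lemma 8.5 (2).  This file states that
lemma as a named fact in the pin's currency (`mem_integralH1_of_forall_layerCores_eq`) and records the
corollary **`mem_pSmul_of_red_eq_zero_of_lemma_8_5` : `mem_integralH1_of_forall_layerCores_eq →
mem_pSmul_of_red_eq_zero`** — so the conditional surface of the crux's `stub_factsX9` may cite Lemma 8.5 (2)
(local Iwasawa theory at `v ∤ p`) in place of the §13.8 statement.

## The printed statement (K. Kato, Astérisque 295 (2004); `[p. N]` = printed page; store key
`paper:doi-10-24033-ast-639`, PDF page `N − 115`)

* **Lemma 8.5 [p. 183]** "Lemma 8.5 ([Pe0, 2.2.4], [Ru4, B3.3]). — Let `K` be a finite extension of `ℚ`,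
  `O_K` the ring of integers of `K`, and let `T` be a finite[ly generated] `ℤ_p` module endowed with a
  continuous action of `Gal(K̄/K)`. Then: (1) For any set `S` of finite places of `K` containing all places
  lying over `p`, the canonical map `H¹(O_K[S⁻¹], T) → H¹(K, T)` is injective. (2) The image of
  `lim←_n H¹(K(ζ_{p^n}), T) → H¹(K, T)` is contained in the image of `H¹(O_K[1/p], T) → H¹(K, T)`."
  Proof [pp. 183–184]: the cokernel of `H¹(O_v, T) → H¹(K_v, T)` (`v ∤ p`) embeds into
  `H⁰(𝔽_v, H¹(K_v^{ur}, T))`, and `lim←_n H¹(𝔽_v(ζ_{p^n}), H⁰(K_v^{ur}, T_v(1)…)) = 0` because "the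
  `p`-cohomological dimension of the field `∪_{n≥1} 𝔽_v(ζ_{p^n})` is zero".

READING (the layer currency of the pin, as in `IwasawaCohomology.lean` / `IwasawaH1Reduction.lean`): for
`T = T_pW` and the cyclotomic `ℤ_p`-extension `κ` of `ℚ` with layers `ℚ_n` (`κ.layerSubgroup n =
Gal(ℚ̄/ℚ_n)`), a family `z_n ∈ H¹(ℚ_n, T_pW)` with `Cor(z_{n+1}) = z_n` for all `n` (`Kato2004.layerCores`,
the "trace maps" of §12.2) has every `z_n` integral, `z_n ∈ H¹(ℤ_n[1/p], T_pW)` (`Kato2004.integralH1`: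
unramified at every prime not above `p`, the image of `H¹(O[1/p], T)` by Lemma 8.5 (1) and §8.2).  This is
(2) with `K = ℚ_n`: a family compatible along `ℚ_m` (`m ≥ n`) restricts to a family compatible along
`ℚ_n(ζ_{p^{m+1}}) = ℚ(ζ_{p^{m+1}})` (`res ∘ Cor = Cor ∘ res`, one double coset since
`[ℚ(ζ_{p^{m+1}}) : ℚ_m] = p − 1` is prime to `p`), whose bottom class `res z_n` is then integral by (2),
and `z_n = (p−1)⁻¹ · Cor(res z_n)` is integral with it.  NOTHING here is specific to elliptic curves
beyond the pin's choice `T = T_pW`.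
-- TODO(general form): Lemma 8.5 (2) for every number field `K`, every finitely generated `ℤ_p`-module
-- `T` with continuous `Gal(K̄/K)`-action unramified almost everywhere, along the tower `K(ζ_{p^n})`.

References: K. Kato, Astérisque 295 (2004) §8.2, Lemma 8.5 (pp. 180–184), §12.2 (p. 220), §13.8
(pp. 228–229) [Kato2004Asterisque]; K. Rubin, *Euler Systems* (2000) App. B, Prop. B.3.3 [Rubin2000]
(Kato's "[Ru4, B3.3]"; his "[Pe0, 2.2.4]" is Perrin-Riou, Astérisque 229 (1995), §2.2.4).
-/

noncomputable section

open scoped NumberField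
open Field
open Literature.NumberTheory.GaloisRepresentations
open Literature.NumberTheory.EllipticCurves Literature.NumberTheory.EllipticCurves.Kato2004
open Literature.NumberTheory.EllipticCurves.Kato2004.EulerSystemValues

namespace Literature.NumberTheory.EllipticCurves.Kato2004

/-- **Kato 2004, Lemma 8.5 (2) [p. 183] ([Pe0, 2.2.4], [Ru4, B3.3]), read on the layers of the cyclotomic
`ℤ_p`-extension for `T = T_pW`: norm-compatible families are integral.**  Printed: "(2) The image of
`lim←_n H¹(K(ζ_{p^n}), T) → H¹(K, T)` is contained in the image of `H¹(O_K[1/p], T) → H¹(K, T)`" (for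
a finite extension `K/ℚ` and a finitely generated `ℤ_p`-module `T` with continuous `Gal(K̄/K)`-action).
ON THE PIN's CURRENCY (module docstring READING): for every elliptic curve `W/ℚ`, prime `p`, cyclotomic
`ℤ_p`-extension `κ` (layers `ℚ_n = ℚ̄^{κ.layerSubgroup n}`) and every family `z_n ∈ H¹(ℚ_n, T_pW)` with
`Cor(z_{n+1}) = z_n` for all `n` (`Kato2004.layerCores`), every `z_n` lies in
`H¹(ℤ_n[1/p], T_pW) = Kato2004.integralH1` (unramified at every prime not above `p`).  Named fact; nothing
asserted; a `_holds` goes through the local statement at `v ∤ p` (universal norms in the unramified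
`ℤ_p`-tower `ℚ_{n,w}` die in `H¹(I_v, T_pW)^{Frob}`, `cd_p(∪_n 𝔽_v(ζ_{p^n})) = 0`) and the Mackey formula
`res_{D_v} ∘ Cor = Cor ∘ res_{D_v}`.  Consumer: `mem_pSmul_of_red_eq_zero_of_lemma_8_5` below.
[cite: Kato2004Asterisque, Lemma 8.5 (2) (p. 183)] -/
def mem_integralH1_of_forall_layerCores_eq : Prop :=
  ∀ (W : WeierstrassCurve ℚ) [W.IsElliptic] (p : ℕ) [Fact p.Prime]
    [ContinuousSMul ℤ_[p] (W.tateModule p)] (κ : ZpExtension ℚ p), κ.IsCyclotomic →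
    ∀ z : ∀ n : ℕ, H1 (tateRep W p) (κ.layerSubgroup n),
      (∀ n, layerCores (tateRep W p) κ n (z (n + 1)) = z n) →
        ∀ n, z n ∈ integralH1 (tateRep W p) p (κ.layerSubgroup n)

/-- **Kato §13.8 "`𝐇¹(T)/p𝐇¹(T) ⊂ 𝐇¹(T/p)`" on the pin follows from Lemma 8.5 (2)**: under
`mem_integralH1_of_forall_layerCores_eq`, the named fact `Kato2004.mem_pSmul_of_red_eq_zero` holds
(`I.red x = 0 → x ∈ (p) • 𝐇¹` for every datum `I : IwasawaH1Data W p κ γ`), by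
`mem_pSmul_of_red_eq_zero_of_integral` (levelwise kernel `reduceH1_eq_zero_iff` + norm-compatible
`p`-th roots `exists_normCompatible_roots` + `proj_surjective`).
[cite: Kato2004Asterisque, §13.8 (pp. 228–229) with Lemma 8.5 (2) (p. 183)] -/
theorem mem_pSmul_of_red_eq_zero_of_lemma_8_5 (h : mem_integralH1_of_forall_layerCores_eq) :
    mem_pSmul_of_red_eq_zero :=
  mem_pSmul_of_red_eq_zero_of_integral h

end Literature.NumberTheory.EllipticCurves.Kato2004

end
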